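import Literature.NumberTheory.GaloisRepresentations.TateH2VanishingArchimedean
import Literature.NumberTheory.GaloisRepresentations.ContinuousH1
import Literature.NumberTheory.GaloisRepresentations.LocalGlobalCohomology
import HarnessLib

/-!
# `2 · H¹(G, X) = 0` for a group of order `≤ 2`; archimedean places

Topic `NumberTheory/GaloisRepresentations`; namespace `Literature.NumberTheory.GaloisRepresentations`.
Theorems only: **no named fact is introduced** (D-0026).

For a topological group `G` of order `≤ 2` and ANY topological representation `X` of `G`, the
continuous cohomology group `H¹(G, X)` (Mathlib `continuousCohomology 1`, described by continuous
crossed homomorphisms in the tree's `ContinuousH1.lean`) is killed by `2`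
(`two_nsmul_continuousCohomology_one_eq_zero_of_natCard_le_two`): for a crossed homomorphism `φ` and
`σ ∈ G`, `σ² = 1` gives `φ σ + σ φ σ = φ 1 = 0`, so `2 φ` is the coboundary of `-φ(c)`, `c` the
non-trivial element.  Hence an element of `H¹(G, X)` killed by an odd integer is `0`
(`eq_zero_of_odd_nsmul_eq_zero_of_natCard_le_two`).  (This is the case `n = 1` of
"`#G · Hⁿ(G, X) = 0`", Serre, *Galois Cohomology*, I §2.4, Cor. of Prop. 9 (restriction–corestriction);
proved here by the direct cocycle computation, the tree having no corestriction for continuous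
cochains.)

Application (`Γ_{K_w}` has order `≤ 2` at an infinite place `w`, tree
`natCard_absoluteGaloisGroup_completion_infinitePlace_le_two`): for every topological
`Γ_{K_w}`-module `X`, `2 · H¹(K_w, X) = 0` and odd-torsion classes of `H¹(K_w, X)` vanish
(`two_nsmul_continuousCohomology_one_infinitePlace_eq_zero`,
`eq_zero_of_odd_nsmul_eq_zero_infinitePlace`); in particular for the local Galois cohomology
`H¹(K_w, M)` of a discrete `Γ_K`-module at the place `Sum.inl w`
(`two_nsmul_galoisCohomology_one_toLocal_inl_eq_zero`, `eq_zero_of_odd_nsmul_galoisCohomology_one_toLocal_inl`).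
So at ODD level `m` the archimedean places impose no local conditions and contribute no local terms
(`H¹(K_w, E[m]) = 0`, `H¹(K_w, E)[m] = 0`): the archimedean input of the Cassels–Tate pairing
(Milne, *ADT*, I Rem. 3.7 and §6, `S ⊇` archimedean places) is vacuous away from `2`.
Motivation: provefact `WeierstrassCurve.exists_casselsTate_pairing`.

## References

* [SerreGaloisCohomology1997] J.-P. Serre, *Galois Cohomology* (1997), I §2.4 (Prop. 9 and its
  corollaries: `Card(G/H) · Ker(Res) = 0`; the case `G = Gal(ℂ/ℝ)`), I §5.1 (crossed homomorphisms).
* [MilneADT2006] J. S. Milne, *Arithmetic Duality Theorems*, 2nd ed. (2006), I Rem. 3.7, §6.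
-/

noncomputable section

universe u v

namespace Literature.NumberTheory.GaloisRepresentations

open _root_.TopRep Function Field NumberField

/-! ## Groups of order `≤ 2` -/

section OrderTwo

variable {R : Type u} [CommRing R] [TopologicalSpace R]
variable {G : Type v} [Group G] [TopologicalSpace G] [IsTopologicalGroup G]

omit [TopologicalSpace G] [IsTopologicalGroup G] in
/-- In a group of order `≤ 2`, every element squares to `1`. [folklore] -/
theorem mul_self_eq_one_of_natCard_le_two [Finite G] (hG : Nat.card G ≤ 2) (σ : G) : σ * σ = 1 := by
  have hpos : 0 < Nat.card G := Nat.card_pos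
  have h : σ ^ Nat.card G = 1 := pow_card_eq_one'
  interval_cases hc : Nat.card G
  · rw [pow_one] at h
    rw [h, mul_one]
  · rwa [pow_two] at h

omit [TopologicalSpace G] [IsTopologicalGroup G] in
/-- In a group of order `≤ 2`, two elements different from `1` are equal. [folklore] -/
theorem eq_of_ne_one_of_natCard_le_two [Finite G] (hG : Nat.card G ≤ 2) {σ c : G} (hσ : σ ≠ 1)
    (hc : c ≠ 1) : σ = c := by
  by_contra hσc
  have hinj : Injective ![(1 : G), σ, c] := by
    intro i j hij
    fin_cases i <;> fin_cases j <;>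
      simp_all [Matrix.cons_val_zero, Matrix.cons_val_one, eq_comm]
  have h3 : Nat.card (Fin 3) ≤ Nat.card G := Nat.card_le_card_of_injective _ hinj
  rw [Nat.card_eq_fintype_card, Fintype.card_fin] at h3
  omega

/-- **`2 · H¹(G, X) = 0` for a group `G` of order `≤ 2`** and any topological representation `X`:
for a continuous crossed homomorphism `φ`, `σ² = 1` gives `φ σ + σ φ σ = φ 1 = 0`, so `2 φ` is the
coboundary `σ ↦ σ v - v` of `v = -φ(c)` (`c` the non-trivial element of `G`, if any).
Serre, *Galois Cohomology*, I §2.4 (Cor. of Prop. 9, `#G · Hⁿ(G, X) = 0`, case `#G ∣ 2`, `n = 1`).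
[cite: SerreGaloisCohomology1997, I §2.4] -/
theorem two_nsmul_continuousCohomology_one_eq_zero_of_natCard_le_two [Finite G]
    (hG : Nat.card G ≤ 2) (X : TopRep.{v} R G) (x : continuousCohomology 1 X) : 2 • x = 0 := by
  obtain ⟨φ, rfl⟩ := oneCocycleClass_surjective X x
  -- `φ σ + σ φ σ = 0`
  have hφ : ∀ σ : G, φ.1 σ + X.ρ σ (φ.1 σ) = 0 := fun σ => by
    have h := φ.2 σ σ
    rw [mul_self_eq_one_of_natCard_le_two hG, contOneCocycles.apply_one] at h
    exact h.symm
  rw [← Nat.cast_smul_eq_nsmul R, ← oneCocycleClass_smul, oneCocycleClass_eq_zero_iff]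
  by_cases h1 : ∃ c : G, c ≠ 1
  · obtain ⟨c, hc⟩ := h1
    refine ⟨-φ.1 c, fun σ => ?_⟩
    change ((2 : ℕ) : R) • φ.1 σ = X.ρ σ (-φ.1 c) - -φ.1 c
    rw [Nat.cast_smul_eq_nsmul, two_nsmul, map_neg, sub_neg_eq_add]
    rcases eq_or_ne σ 1 with rfl | hσ
    · rw [contOneCocycles.apply_one, add_zero, _root_.map_one X.ρ]
      exact (neg_add_cancel (φ.1 c)).symm
    · obtain rfl : σ = c := eq_of_ne_one_of_natCard_le_two hG hσ hc
      rw [← sub_eq_zero]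
      have h := hφ σ
      calc φ.1 σ + φ.1 σ - (-(X.ρ σ (φ.1 σ)) + φ.1 σ)
          = φ.1 σ + X.ρ σ (φ.1 σ) := by abel
        _ = 0 := h
  · push Not at h1
    refine ⟨0, fun σ => ?_⟩
    change ((2 : ℕ) : R) • φ.1 σ = X.ρ σ 0 - 0
    rw [h1 σ, contOneCocycles.apply_one, smul_zero, map_zero, sub_zero]

/-- **Odd torsion of `H¹(G, X)` vanishes for a group of order `≤ 2`**: if `n` is odd and `n · x = 0`
then `x = 0` (`2 · x = 0` and `gcd(2, n) = 1`). [cite: SerreGaloisCohomology1997, I §2.4] -/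
theorem eq_zero_of_odd_nsmul_eq_zero_of_natCard_le_two [Finite G] (hG : Nat.card G ≤ 2)
    (X : TopRep.{v} R G) {n : ℕ} (hn : Odd n) (x : continuousCohomology 1 X) (hx : n • x = 0) :
    x = 0 := by
  have h := _root_.gcd_nsmul_eq_zero.2
    ⟨two_nsmul_continuousCohomology_one_eq_zero_of_natCard_le_two hG X x, hx⟩
  rwa [Nat.Coprime.gcd_eq_one (Nat.coprime_two_left.mpr hn), one_nsmul] at h

end OrderTwo

/-! ## Archimedean places -/

section InfinitePlace

variable {R : Type u} [CommRing R] [TopologicalSpace R]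
variable {K : Type v} [Field K]

/-- **`2 · H¹(K_w, X) = 0` at an infinite place `w`**, for every topological `Γ_{K_w}`-module `X`
(`Γ_{K_w} = Gal(ℂ/K_w)` has order `≤ 2`). Serre, *Galois Cohomology*, I §2.4; Milne, *ADT*, I Rem. 3.7
(the groups `H^r(ℝ, ·)` are killed by `2`). [cite: SerreGaloisCohomology1997, I §2.4] -/
theorem two_nsmul_continuousCohomology_one_infinitePlace_eq_zero (w : InfinitePlace K)
    (X : TopRep.{v} R (absoluteGaloisGroup w.Completion)) (x : continuousCohomology 1 X) :
    2 • x = 0 := by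
  haveI := finite_absoluteGaloisGroup_completion_infinitePlace w
  exact two_nsmul_continuousCohomology_one_eq_zero_of_natCard_le_two
    (natCard_absoluteGaloisGroup_completion_infinitePlace_le_two w) X x

/-- **Odd-torsion classes of `H¹(K_w, X)` vanish at an infinite place `w`.** In particular, at odd
level `m`, `H¹(K_w, E[m]) = 0` and `H¹(K_w, E)[m] = 0`: the archimedean places impose no local
condition and contribute no local term (Milne, *ADT*, I §6 with Rem. 3.7).
[cite: SerreGaloisCohomology1997, I §2.4] -/
theorem eq_zero_of_odd_nsmul_eq_zero_infinitePlace (w : InfinitePlace K)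
    (X : TopRep.{v} R (absoluteGaloisGroup w.Completion)) {n : ℕ} (hn : Odd n)
    (x : continuousCohomology 1 X) (hx : n • x = 0) : x = 0 := by
  haveI := finite_absoluteGaloisGroup_completion_infinitePlace w
  exact eq_zero_of_odd_nsmul_eq_zero_of_natCard_le_two
    (natCard_absoluteGaloisGroup_completion_infinitePlace_le_two w) X hn x hx

variable [NumberField K] {M : Type v} [AddCommGroup M] [TopologicalSpace M] [DiscreteTopology M]

/-- **`2 · H¹(K_w, M) = 0`** for the local Galois cohomology of a discrete `Γ_K`-module `M` at the
infinite place `Sum.inl w` of a number field (`DiscreteGaloisModule.toLocal`).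
[cite: SerreGaloisCohomology1997, I §2.4] -/
theorem two_nsmul_galoisCohomology_one_toLocal_inl_eq_zero (ρ : DiscreteGaloisModule K M)
    (w : InfinitePlace K) (x : galoisCohomology (ρ.toLocal (Sum.inl w)) 1) : 2 • x = 0 :=
  two_nsmul_continuousCohomology_one_infinitePlace_eq_zero w _ x

/-- **Odd-torsion classes of `H¹(K_w, M)` vanish** at the infinite place `Sum.inl w` of a number
field: `n` odd and `n · x = 0` imply `x = 0`; e.g. `H¹(K_w, M) = 0` whenever `M` is killed by an odd
integer (tree `galoisCohomology.nsmul_eq_zero_of_forall`). [cite: SerreGaloisCohomology1997, I §2.4] -/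
theorem eq_zero_of_odd_nsmul_galoisCohomology_one_toLocal_inl (ρ : DiscreteGaloisModule K M)
    (w : InfinitePlace K) {n : ℕ} (hn : Odd n) (x : galoisCohomology (ρ.toLocal (Sum.inl w)) 1)
    (hx : n • x = 0) : x = 0 :=
  eq_zero_of_odd_nsmul_eq_zero_infinitePlace w _ hn x hx

end InfinitePlace

end Literature.NumberTheory.GaloisRepresentations

end
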